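import Mathlib.Algebra.Module.CharacterModule
import Mathlib.NumberTheory.Padics.RingHoms
import Mathlib.Algebra.Polynomial.Monomial
import Mathlib.Topology.Instances.AddCircle.Defs
import HarnessLib

/-!
# The pairing characters `z ↦ z(x)/p^k` of `Hom(N, ℤ_p)` and Pontryagin biduality for the pair
# `(N ⊗ ℚ_p/ℤ_p, Hom(N, ℤ_p))`: every character of the group of pairing characters is an evaluation

Topic `Algebra/Module`; namespace `Literature.Algebra.Module`; companion of `PadicFunctionalSeparation.lean`
(which proves the SEPARATION half: `ℤ_p`-valued functionals detect `p^k N`). Mathlib-only imports. THEOREMS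
ONLY (no definition, no named fact, no instance): the objects are quantified as a **pairing-character family**
`e : N → ℕ → Hom(Hom(N, ℤ_p), ℚ/ℤ)` with the defining property
`he : toZModPow k (z x) = a ⇒ e x k z = a/p^k` (i.e. `e x k` is `z ↦ z(x)/p^k mod ℤ`, the local Tate pairing of
the functional `z` with the Kummer class of `x ⊗ p^{-k}`, in the transcription of Iwasawa cohomology as
`ℤ_p`-valued functionals on points used by `Literature/NumberTheory/EllipticCurves/Sprung2012/ColemanMaps.lean`);
such a family EXISTS (`exists_padicPairingFamily`), is unique by `he`, and the set of all `e x k` is a subgroup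
`D` (`exists_addSubgroup_padicPairingFamily`) — a concrete model of `N ⊗ ℚ_p/ℤ_p` inside the character group of
`𝓗 = Hom(N, ℤ_p)` (it IS `N ⊗ ℚ_p/ℤ_p` when `N` has no `p`-torsion, by `exists_addMonoidHom_padicInt_not_dvd`).
Proved here:
* API of a pairing family: `padicPairingFamily_apply_eq_zero_iff` (`e x k z = 0 ↔ p^k ∣ z(x)`), `_zero_right`,
  `_add_left`, `_neg_left`, `_pow_nsmul_left` (`(p^j x, j+k) ∼ (x, k)`), `_nsmul_succ` (`p·(x,k+1) = (x,k)`),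
  `_pow_nsmul` (`p^k·(x,k) = 0`), `_eq_iff` (`(a,k) ∼ (b,k) ↔ ∀ z, p^k ∣ z(a − b)`);
* **`exists_eval_eq_of_character_padicPairingFamily`** — every character `Φ` of the subgroup `D` of pairing
  characters is the evaluation at some `w ∈ Hom(N, ℤ_p)`: `Φ(d) = d(w)` (the residues `Φ(x,k) = a_k(x)/p^k` are
  compatible in `k` and additive in `x`, and assemble — Mathlib `PadicInt.lift` on `ℤ[X]`, `X ↦ a_k(x)`, as in
  `exists_addMonoidHom_padicInt_lift_character` — into `w(x) ∈ ℤ_p`). This is Pontryagin biduality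
  `(N ⊗ ℚ_p/ℤ_p)^∨ = Hom(N, ℤ_p)` [cite: NeukirchSchmidtWingberg2008, I §1 (1.1.8) (Pontryagin duality)] in the
  tree's currency.
USE (cell `bsd-2adic`, seat `bsd-2adic-ss-1` GEN 13, crux stmt-BirchSwinnertonDyer-19097): the vanishing of the
`Γ`-coinvariants of Sprung's ♭-local condition `E♭_{∞,𝔭}` at `p = 2`
(`Summits/…/Theorems/ByReductionTypeAtTwoSupersingularFlatAnnihilatorDivisible.lean`). Nothing specific to
elliptic curves is used here.

## References
* [NeukirchSchmidtWingberg2008] J. Neukirch, A. Schmidt, K. Wingberg, *Cohomology of Number Fields*, 2nd ed.,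
  I §1 (1.1.8) (Pontryagin duality).
* [Sprung2012] F. Sprung, J. Number Theory 132 (2012), Def. 7.9, Lemma 7.10 (p. 1503) (the local Tate pairing
  `lim← H¹(K_{n,𝔭}, T) × lim→ H¹(K_{n,𝔭}, V/T) → ℚ_p/ℤ_p`).
-/

set_option autoImplicit false

noncomputable section

open scoped Classical

namespace Literature.Algebra.Module

variable {N : Type*} [AddCommGroup N] {p : ℕ} [hp : Fact p.Prime]

/-! ## §1 Classes `a / p^k` in `ℚ/ℤ` -/

/-- The class of `a / p^k` in `ℚ/ℤ` vanishes iff `p^k ∣ a`. [folklore] -/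
private theorem coe_intCast_div_pow_eq_zero_iff {k : ℕ} (a : ℤ) :
    ((((a : ℚ) / (p : ℚ) ^ k : ℚ)) : AddCircle (1 : ℚ)) = 0 ↔ ((p : ℤ) ^ k ∣ a) := by
  have hpm : ((p : ℚ) ^ k) ≠ 0 := pow_ne_zero _ (Nat.cast_ne_zero.mpr hp.out.ne_zero)
  rw [AddCircle.coe_eq_zero_iff]
  constructor
  · rintro ⟨n, hn⟩
    rw [zsmul_eq_mul, mul_one, eq_div_iff hpm] at hn
    refine ⟨n, ?_⟩
    have h' : (((p : ℤ) ^ k * n : ℤ) : ℚ) = (a : ℚ) := by push_cast; rw [mul_comm]; exact hn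
    exact (Int.cast_injective h').symm
  · rintro ⟨n, rfl⟩
    refine ⟨n, ?_⟩
    rw [zsmul_eq_mul, mul_one, eq_div_iff hpm]
    push_cast
    ring

/-- Two classes `a/p^k`, `b/p^k` in `ℚ/ℤ` agree iff `p^k ∣ a − b`. [folklore] -/
private theorem coe_intCast_div_pow_eq_iff {k : ℕ} (a b : ℤ) :
    ((((a : ℚ) / (p : ℚ) ^ k : ℚ)) : AddCircle (1 : ℚ)) = (((b : ℚ) / (p : ℚ) ^ k : ℚ) : AddCircle (1 : ℚ)) ↔
      ((p : ℤ) ^ k ∣ a - b) := by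
  rw [← sub_eq_zero, ← AddCircle.coe_sub, ← sub_div, ← Int.cast_sub, coe_intCast_div_pow_eq_zero_iff]

/-- Classes `a/p^k` and `b/p^k` agree when `a ≡ b` in `ℤ/p^k`. [folklore] -/
private theorem coe_intCast_div_pow_eq_of_cast_eq {k : ℕ} {a b : ℤ} (h : (a : ZMod (p ^ k)) = b) :
    ((((a : ℚ) / (p : ℚ) ^ k : ℚ)) : AddCircle (1 : ℚ)) = (((b : ℚ) / (p : ℚ) ^ k : ℚ) : AddCircle (1 : ℚ)) := by
  rw [coe_intCast_div_pow_eq_iff]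
  have h' := (ZMod.intCast_eq_intCast_iff_dvd_sub a b (p ^ k)).mp h
  rw [Nat.cast_pow] at h'
  rwa [← dvd_neg, neg_sub]

/-- `p^k ∣ a` in `ℤ_p` iff the reduction of `a` modulo `p^k` vanishes. [folklore] -/
private theorem padicInt_pow_dvd_iff_toZModPow_eq_zero {k : ℕ} (a : ℤ_[p]) :
    (p : ℤ_[p]) ^ k ∣ a ↔ PadicInt.toZModPow k a = 0 := by
  rw [← RingHom.mem_ker, PadicInt.ker_toZModPow, Ideal.mem_span_singleton]

/-! ## §2 Pairing-character families `e x k = (z ↦ z(x)/p^k)` -/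

/-- **A pairing-character family exists**: `e x k : Hom(N, ℤ_p) → ℚ/ℤ`, `z ↦ z(x)/p^k mod ℤ` (computed from the
residue of `z(x)` in `ℤ/p^k`), additive in `z`. [cite: NeukirchSchmidtWingberg2008, I §1 (1.1.8) (the pairing N ⊗ ℚ_p/ℤ_p × Hom(N, ℤ_p) → ℚ/ℤ)] -/
theorem exists_padicPairingFamily :
    ∃ e : N → ℕ → ((N →+ ℤ_[p]) →+ AddCircle (1 : ℚ)),
      ∀ (x : N) (k : ℕ) (z : N →+ ℤ_[p]) (a : ℤ), PadicInt.toZModPow k (z x) = (a : ZMod (p ^ k)) →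
        e x k z = (((a : ℚ) / (p : ℚ) ^ k : ℚ) : AddCircle (1 : ℚ)) := by
  refine ⟨fun x k ↦
    { toFun := fun z ↦ (((((PadicInt.toZModPow k (z x)).val : ℤ) : ℚ) / (p : ℚ) ^ k : ℚ) : AddCircle (1 : ℚ))
      map_zero' := by simp
      map_add' := fun z z' ↦ by
        rw [← AddCircle.coe_add, ← add_div, ← Int.cast_add]
        apply coe_intCast_div_pow_eq_of_cast_eq
        push_cast
        rw [ZMod.natCast_zmod_val, ZMod.natCast_zmod_val, ZMod.natCast_zmod_val, AddMonoidHom.add_apply,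
          map_add] }, fun x k z a ha ↦ ?_⟩
  change (((((PadicInt.toZModPow k (z x)).val : ℤ) : ℚ) / (p : ℚ) ^ k : ℚ) : AddCircle (1 : ℚ)) = _
  apply coe_intCast_div_pow_eq_of_cast_eq
  rw [Int.cast_natCast, ZMod.natCast_zmod_val, ha]

variable {e : N → ℕ → ((N →+ ℤ_[p]) →+ AddCircle (1 : ℚ))}

/-- **`e x k z = 0 ↔ p^k ∣ z(x)`** for a pairing-character family. [cite: NeukirchSchmidtWingberg2008, I §1 (1.1.8) (the pairing N ⊗ ℚ_p/ℤ_p × Hom(N, ℤ_p) → ℚ/ℤ)] -/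
theorem padicPairingFamily_apply_eq_zero_iff
    (he : ∀ (x : N) (k : ℕ) (z : N →+ ℤ_[p]) (a : ℤ), PadicInt.toZModPow k (z x) = (a : ZMod (p ^ k)) →
      e x k z = (((a : ℚ) / (p : ℚ) ^ k : ℚ) : AddCircle (1 : ℚ))) (x : N) (k : ℕ) (z : N →+ ℤ_[p]) :
    e x k z = 0 ↔ (p : ℤ_[p]) ^ k ∣ z x := by
  obtain ⟨a, ha⟩ := ZMod.intCast_surjective (PadicInt.toZModPow k (z x))
  rw [he x k z a ha.symm, coe_intCast_div_pow_eq_zero_iff, padicInt_pow_dvd_iff_toZModPow_eq_zero, ← ha,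
    ZMod.intCast_zmod_eq_zero_iff_dvd, Nat.cast_pow]

/-- Level `0`: `e x 0 = 0`. [cite: NeukirchSchmidtWingberg2008, I §1 (1.1.8) (the pairing N ⊗ ℚ_p/ℤ_p × Hom(N, ℤ_p) → ℚ/ℤ)] -/
theorem padicPairingFamily_zero_right (he : ∀ (x : N) (k : ℕ) (z : N →+ ℤ_[p]) (a : ℤ), PadicInt.toZModPow k (z x) = (a : ZMod (p ^ k)) →
      e x k z = (((a : ℚ) / (p : ℚ) ^ k : ℚ) : AddCircle (1 : ℚ))) (x : N) : e x 0 = 0 := by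
  ext z
  rw [AddMonoidHom.zero_apply, padicPairingFamily_apply_eq_zero_iff he, pow_zero]
  exact one_dvd _

/-- Additivity in the point: `e (x + y) k = e x k + e y k`. [cite: NeukirchSchmidtWingberg2008, I §1 (1.1.8) (the pairing N ⊗ ℚ_p/ℤ_p × Hom(N, ℤ_p) → ℚ/ℤ)] -/
theorem padicPairingFamily_add_left (he : ∀ (x : N) (k : ℕ) (z : N →+ ℤ_[p]) (a : ℤ), PadicInt.toZModPow k (z x) = (a : ZMod (p ^ k)) →
      e x k z = (((a : ℚ) / (p : ℚ) ^ k : ℚ) : AddCircle (1 : ℚ))) (x y : N) (k : ℕ) : e (x + y) k = e x k + e y k := by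
  ext z
  obtain ⟨a, ha⟩ := ZMod.intCast_surjective (PadicInt.toZModPow k (z x))
  obtain ⟨b, hb⟩ := ZMod.intCast_surjective (PadicInt.toZModPow k (z y))
  have hab : PadicInt.toZModPow k (z (x + y)) = ((a + b : ℤ) : ZMod (p ^ k)) := by
    rw [map_add, map_add, ← ha, ← hb, Int.cast_add]
  rw [AddMonoidHom.add_apply, he x k z a ha.symm, he y k z b hb.symm, he (x + y) k z (a + b) hab,
    ← AddCircle.coe_add, ← add_div, Int.cast_add]

/-- Negation in the point: `e (−x) k = −e x k`. [cite: NeukirchSchmidtWingberg2008, I §1 (1.1.8) (the pairing N ⊗ ℚ_p/ℤ_p × Hom(N, ℤ_p) → ℚ/ℤ)] -/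
theorem padicPairingFamily_neg_left (he : ∀ (x : N) (k : ℕ) (z : N →+ ℤ_[p]) (a : ℤ), PadicInt.toZModPow k (z x) = (a : ZMod (p ^ k)) →
      e x k z = (((a : ℚ) / (p : ℚ) ^ k : ℚ) : AddCircle (1 : ℚ))) (x : N) (k : ℕ) : e (-x) k = -e x k := by
  rw [eq_neg_iff_add_eq_zero, ← padicPairingFamily_add_left he, neg_add_cancel]
  ext z
  rw [AddMonoidHom.zero_apply, padicPairingFamily_apply_eq_zero_iff he, map_zero]
  exact dvd_zero _

/-- Rescaling: `e (p^j x) (j + k) = e x k` (`p^j x ⊗ p^{-(j+k)} = x ⊗ p^{-k}`). [cite: NeukirchSchmidtWingberg2008, I §1 (1.1.8) (the pairing N ⊗ ℚ_p/ℤ_p × Hom(N, ℤ_p) → ℚ/ℤ)] -/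
theorem padicPairingFamily_pow_nsmul_left (he : ∀ (x : N) (k : ℕ) (z : N →+ ℤ_[p]) (a : ℤ), PadicInt.toZModPow k (z x) = (a : ZMod (p ^ k)) →
      e x k z = (((a : ℚ) / (p : ℚ) ^ k : ℚ) : AddCircle (1 : ℚ))) (x : N) (j k : ℕ) : e (p ^ j • x) (j + k) = e x k := by
  ext z
  obtain ⟨a, ha⟩ := ZMod.intCast_surjective (PadicInt.toZModPow (j + k) (z x))
  have hk : PadicInt.toZModPow k (z x) = (a : ZMod (p ^ k)) := by
    have h := congrArg (ZMod.castHom (pow_dvd_pow p (show k ≤ j + k by omega)) (ZMod (p ^ k))) ha.symm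
    rw [map_intCast, ← RingHom.comp_apply, PadicInt.zmod_cast_comp_toZModPow k (j + k) (by omega)] at h
    exact h
  have hjk : PadicInt.toZModPow (j + k) (z (p ^ j • x)) = ((p ^ j * a : ℤ) : ZMod (p ^ (j + k))) := by
    rw [map_nsmul, nsmul_eq_mul, map_mul, ← ha, map_natCast]
    push_cast
    ring
  rw [he _ _ z _ hjk, he _ _ z _ hk]
  congr 1
  have hp0 : (p : ℚ) ≠ 0 := Nat.cast_ne_zero.mpr hp.out.ne_zero
  push_cast
  rw [pow_add, mul_div_mul_left _ _ (pow_ne_zero _ hp0)]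

/-- `p • e x (k+1) = e x k` (`p·(x ⊗ p^{-k-1}) = x ⊗ p^{-k}`). [cite: NeukirchSchmidtWingberg2008, I §1 (1.1.8) (the pairing N ⊗ ℚ_p/ℤ_p × Hom(N, ℤ_p) → ℚ/ℤ)] -/
theorem padicPairingFamily_nsmul_succ (he : ∀ (x : N) (k : ℕ) (z : N →+ ℤ_[p]) (a : ℤ), PadicInt.toZModPow k (z x) = (a : ZMod (p ^ k)) →
      e x k z = (((a : ℚ) / (p : ℚ) ^ k : ℚ) : AddCircle (1 : ℚ))) (x : N) (k : ℕ) : p • e x (k + 1) = e x k := by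
  ext z
  obtain ⟨a, ha⟩ := ZMod.intCast_surjective (PadicInt.toZModPow (k + 1) (z x))
  have hk : PadicInt.toZModPow k (z x) = (a : ZMod (p ^ k)) := by
    have h := congrArg (ZMod.castHom (pow_dvd_pow p (Nat.le_succ k)) (ZMod (p ^ k))) ha.symm
    rw [map_intCast, ← RingHom.comp_apply, PadicInt.zmod_cast_comp_toZModPow k (k + 1) (Nat.le_succ k)] at h
    exact h
  rw [AddMonoidHom.nsmul_apply, he _ _ z _ ha.symm, he _ _ z _ hk, ← AddCircle.coe_nsmul]
  congr 1
  have hp0 : (p : ℚ) ≠ 0 := Nat.cast_ne_zero.mpr hp.out.ne_zero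
  rw [nsmul_eq_mul, pow_succ, ← mul_div_assoc, mul_comm (p : ℚ), mul_div_mul_right _ _ hp0]

/-- `p^k • e x k = 0` (`x ⊗ p^{-k}` is `p^k`-torsion). [cite: NeukirchSchmidtWingberg2008, I §1 (1.1.8) (the pairing N ⊗ ℚ_p/ℤ_p × Hom(N, ℤ_p) → ℚ/ℤ)] -/
theorem padicPairingFamily_pow_nsmul (he : ∀ (x : N) (k : ℕ) (z : N →+ ℤ_[p]) (a : ℤ), PadicInt.toZModPow k (z x) = (a : ZMod (p ^ k)) →
      e x k z = (((a : ℚ) / (p : ℚ) ^ k : ℚ) : AddCircle (1 : ℚ))) (x : N) (k : ℕ) : p ^ k • e x k = 0 := by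
  induction k with
  | zero => rw [pow_zero, one_smul, padicPairingFamily_zero_right he]
  | succ k ih => rw [pow_succ, mul_smul, padicPairingFamily_nsmul_succ he, ih]

/-- **Equality of pairing characters**: `e a k = e b k` iff every functional is divisible by `p^k` at `a − b`.
[cite: NeukirchSchmidtWingberg2008, I §1 (1.1.8) (the pairing N ⊗ ℚ_p/ℤ_p × Hom(N, ℤ_p) → ℚ/ℤ)] -/
theorem padicPairingFamily_eq_iff (he : ∀ (x : N) (k : ℕ) (z : N →+ ℤ_[p]) (a : ℤ), PadicInt.toZModPow k (z x) = (a : ZMod (p ^ k)) →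
      e x k z = (((a : ℚ) / (p : ℚ) ^ k : ℚ) : AddCircle (1 : ℚ))) (a b : N) (k : ℕ) :
    e a k = e b k ↔ ∀ z : N →+ ℤ_[p], (p : ℤ_[p]) ^ k ∣ z (a - b) := by
  rw [← sub_eq_zero, sub_eq_add_neg, ← padicPairingFamily_neg_left he, ← padicPairingFamily_add_left he,
    ← sub_eq_add_neg, AddMonoidHom.ext_iff]
  exact forall_congr' fun z ↦ by rw [AddMonoidHom.zero_apply, padicPairingFamily_apply_eq_zero_iff he]

/-! ## §3 The group of pairing characters and its characters -/

/-- **The pairing characters form a subgroup** `D = {e x k} ⊆ Hom(Hom(N, ℤ_p), ℚ/ℤ)` — the image of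
`N ⊗ ℚ_p/ℤ_p` (closed under sums by `(x,k) + (y,j) = (p^j x + p^k y, j + k)`). [cite: NeukirchSchmidtWingberg2008, I §1 (1.1.8) (the pairing N ⊗ ℚ_p/ℤ_p × Hom(N, ℤ_p) → ℚ/ℤ)] -/
theorem exists_addSubgroup_padicPairingFamily (he : ∀ (x : N) (k : ℕ) (z : N →+ ℤ_[p]) (a : ℤ), PadicInt.toZModPow k (z x) = (a : ZMod (p ^ k)) →
      e x k z = (((a : ℚ) / (p : ℚ) ^ k : ℚ) : AddCircle (1 : ℚ))) :
    ∃ D : AddSubgroup ((N →+ ℤ_[p]) →+ AddCircle (1 : ℚ)),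
      ∀ d, d ∈ D ↔ ∃ (x : N) (k : ℕ), d = e x k := by
  let D : AddSubgroup ((N →+ ℤ_[p]) →+ AddCircle (1 : ℚ)) :=
    { carrier := setOf fun d ↦ ∃ (x : N) (k : ℕ), d = e x k
      zero_mem' := ⟨0, 0, (padicPairingFamily_zero_right he (0 : N)).symm⟩
      add_mem' := by
        rintro _ _ ⟨x, k, rfl⟩ ⟨y, j, rfl⟩
        refine ⟨p ^ j • x + p ^ k • y, j + k, ?_⟩
        rw [padicPairingFamily_add_left he, padicPairingFamily_pow_nsmul_left he, add_comm j k,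
          padicPairingFamily_pow_nsmul_left he]
      neg_mem' := by
        rintro _ ⟨x, k, rfl⟩
        exact ⟨-x, k, (padicPairingFamily_neg_left he x k).symm⟩ }
  exact ⟨D, fun d ↦ Iff.rfl⟩

/-- The residue of a character `Φ` of the pairing subgroup at `(x, k)`: `Φ(e x k) = a/p^k` for some integer
`a`. [folklore] -/
private theorem exists_residue_of_character (he : ∀ (x : N) (k : ℕ) (z : N →+ ℤ_[p]) (a : ℤ), PadicInt.toZModPow k (z x) = (a : ZMod (p ^ k)) →
      e x k z = (((a : ℚ) / (p : ℚ) ^ k : ℚ) : AddCircle (1 : ℚ)))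
    {D : AddSubgroup ((N →+ ℤ_[p]) →+ AddCircle (1 : ℚ))} (hD : ∀ d, d ∈ D ↔ ∃ (x : N) (k : ℕ), d = e x k)
    (Φ : D →+ AddCircle (1 : ℚ)) (x : N) (k : ℕ) :
    ∃ a : ℤ, Φ ⟨e x k, (hD _).mpr ⟨x, k, rfl⟩⟩ = (((a : ℚ) / (p : ℚ) ^ k : ℚ) : AddCircle (1 : ℚ)) := by
  have htors : p ^ k • Φ ⟨e x k, (hD _).mpr ⟨x, k, rfl⟩⟩ = 0 := by
    rw [← map_nsmul]
    have : p ^ k • (⟨e x k, (hD _).mpr ⟨x, k, rfl⟩⟩ : D) = 0 :=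
      Subtype.ext (by rw [AddSubgroup.coe_nsmul, padicPairingFamily_pow_nsmul he]; rfl)
    rw [this, map_zero]
  generalize hu : Φ ⟨e x k, (hD _).mpr ⟨x, k, rfl⟩⟩ = u at htors ⊢
  induction u using QuotientAddGroup.induction_on with
  | H q =>
    change p ^ k • ((q : ℚ) : AddCircle (1 : ℚ)) = 0 at htors
    rw [← AddCircle.coe_nsmul, AddCircle.coe_eq_zero_iff] at htors
    obtain ⟨a, ha⟩ := htors
    refine ⟨a, ?_⟩
    change ((q : ℚ) : AddCircle (1 : ℚ)) = _
    congr 1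
    have hpm : ((p : ℚ) ^ k) ≠ 0 := pow_ne_zero _ (Nat.cast_ne_zero.mpr hp.out.ne_zero)
    rw [eq_div_iff hpm]
    rw [zsmul_eq_mul, mul_one, nsmul_eq_mul, Nat.cast_pow] at ha
    rw [mul_comm]
    exact ha.symm

/-- **Pontryagin biduality `(N ⊗ ℚ_p/ℤ_p)^∨ = Hom(N, ℤ_p)`, evaluation form.** Every character `Φ` of the group `D`
of pairing characters is the evaluation at a functional `w : N → ℤ_p`: `Φ(d) = d(w)` for all `d ∈ D`.
Construction: the residues `Φ(e x k) = a_k(x)/p^k` are compatible (`p·e x (k+1) = e x k`) and additive in `x`;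
they assemble into `w(x) = lim_k a_k(x) ∈ ℤ_p` (Mathlib `PadicInt.lift` on the ring homomorphisms
`ℤ[X] → ℤ/p^k`, `X ↦ a_k(x)`). [cite: NeukirchSchmidtWingberg2008, I §1 (1.1.8) (Pontryagin duality)] -/
theorem exists_eval_eq_of_character_padicPairingFamily (he : ∀ (x : N) (k : ℕ) (z : N →+ ℤ_[p]) (a : ℤ), PadicInt.toZModPow k (z x) = (a : ZMod (p ^ k)) →
      e x k z = (((a : ℚ) / (p : ℚ) ^ k : ℚ) : AddCircle (1 : ℚ)))
    {D : AddSubgroup ((N →+ ℤ_[p]) →+ AddCircle (1 : ℚ))} (hD : ∀ d, d ∈ D ↔ ∃ (x : N) (k : ℕ), d = e x k)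
    (Φ : D →+ AddCircle (1 : ℚ)) :
    ∃ w : N →+ ℤ_[p], ∀ d : D, Φ d = (d : (N →+ ℤ_[p]) →+ AddCircle (1 : ℚ)) w := by
  have hmem : ∀ (x : N) (k : ℕ), e x k ∈ D := fun x k ↦ (hD _).mpr ⟨x, k, rfl⟩
  -- residues `r k x ∈ ℤ/p^k` with `Φ(e x k) = r/p^k`
  have hres : ∀ (k : ℕ) (x : N), ∃ r : ZMod (p ^ k), ∀ a : ℤ,
      Φ ⟨e x k, hmem x k⟩ = (((a : ℚ) / (p : ℚ) ^ k : ℚ) : AddCircle (1 : ℚ)) ↔ r = (a : ZMod (p ^ k)) := by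
    intro k x
    obtain ⟨a₀, ha₀⟩ := exists_residue_of_character he hD Φ x k
    refine ⟨(a₀ : ZMod (p ^ k)), fun a ↦ ?_⟩
    rw [ha₀, coe_intCast_div_pow_eq_iff, ZMod.intCast_eq_intCast_iff_dvd_sub, Nat.cast_pow]
    rw [← dvd_neg, neg_sub]
  choose r hr using hres
  have hrΦ : ∀ (k : ℕ) (x : N) (a : ℤ), r k x = a →
      Φ ⟨e x k, hmem x k⟩ = (((a : ℚ) / (p : ℚ) ^ k : ℚ) : AddCircle (1 : ℚ)) :=
    fun k x a h ↦ (hr k x a).mpr h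
  -- additivity of the residues in `x`
  have hradd : ∀ (k : ℕ) (x y : N), r k (x + y) = r k x + r k y := by
    intro k x y
    obtain ⟨a, ha⟩ := ZMod.intCast_surjective (r k x)
    obtain ⟨b, hb⟩ := ZMod.intCast_surjective (r k y)
    have h : Φ ⟨e (x + y) k, hmem (x + y) k⟩ = ((((a + b : ℤ) : ℚ) / (p : ℚ) ^ k : ℚ) : AddCircle (1 : ℚ)) := by
      have hsum : (⟨e (x + y) k, hmem (x + y) k⟩ : D) = ⟨e x k, hmem x k⟩ + ⟨e y k, hmem y k⟩ :=
        Subtype.ext (padicPairingFamily_add_left he x y k)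
      rw [hsum, map_add, hrΦ k x a ha.symm, hrΦ k y b hb.symm, ← AddCircle.coe_add, ← add_div, Int.cast_add]
    rw [(hr k (x + y) (a + b)).mp h, Int.cast_add, ha, hb]
  -- compatibility of successive residues
  have hcompat1 : ∀ (k : ℕ) (x : N),
      ZMod.castHom (pow_dvd_pow p (Nat.le_succ k)) (ZMod (p ^ k)) (r (k + 1) x) = r k x := by
    intro k x
    obtain ⟨a, ha⟩ := ZMod.intCast_surjective (r (k + 1) x)
    have h1 := hrΦ (k + 1) x a ha.symm
    have h2 : Φ ⟨e x k, hmem x k⟩ = (((a : ℚ) / (p : ℚ) ^ k : ℚ) : AddCircle (1 : ℚ)) := by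
      have hsucc : (⟨e x k, hmem x k⟩ : D) = p • ⟨e x (k + 1), hmem x (k + 1)⟩ :=
        Subtype.ext (by rw [AddSubgroup.coe_nsmul, padicPairingFamily_nsmul_succ he])
      have hp0 : (p : ℚ) ≠ 0 := Nat.cast_ne_zero.mpr hp.out.ne_zero
      rw [hsucc, map_nsmul, h1, ← AddCircle.coe_nsmul]
      congr 1
      rw [nsmul_eq_mul, pow_succ, ← mul_div_assoc, mul_comm (p : ℚ), mul_div_mul_right _ _ hp0]
    rw [← ha, map_intCast, ((hr k x a).mp h2)]
  have hstep : ∀ (k : ℕ) (x : N) (a : ℤ), r (k + 1) x = a → r k x = a := by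
    intro k x a h
    rw [← hcompat1 k x, h, map_intCast]
  have hcompatInt : ∀ (d k1 : ℕ) (x : N) (a : ℤ), r (k1 + d) x = a → r k1 x = a := by
    intro d
    induction d with
    | zero => intro k1 x a h; exact h
    | succ d ih => intro k1 x a h; exact ih k1 x a (hstep (k1 + d) x a h)
  have hcompat : ∀ (k1 k2 : ℕ) (hk : k1 ≤ k2) (x : N),
      ZMod.castHom (pow_dvd_pow p hk) (ZMod (p ^ k1)) (r k2 x) = r k1 x := by
    intro k1 k2 hk x
    obtain ⟨d, rfl⟩ := Nat.exists_eq_add_of_le hk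
    obtain ⟨a, ha⟩ := ZMod.intCast_surjective (r (k1 + d) x)
    rw [← ha, map_intCast]
    exact (hcompatInt d k1 x a ha.symm).symm
  -- ring homomorphisms `ℤ[X] → ℤ/p^k`, `X ↦ r k x`, and their compatibility
  let f : N → ∀ k : ℕ, Polynomial ℤ →+* ZMod (p ^ k) := fun x k ↦
    Polynomial.eval₂RingHom (Int.castRingHom (ZMod (p ^ k))) (r k x)
  have hfX : ∀ x k, f x k Polynomial.X = r k x := fun x k ↦ Polynomial.eval₂_X _ _
  have hfcompat : ∀ (x : N) (k1 k2 : ℕ) (hk : k1 ≤ k2),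
      (ZMod.castHom (pow_dvd_pow p hk) (ZMod (p ^ k1))).comp (f x k2) = f x k1 := by
    intro x k1 k2 hk
    refine Polynomial.ringHom_ext (fun a ↦ by simp [f]) ?_
    rw [RingHom.comp_apply, hfX, hfX, hcompat k1 k2 hk x]
  -- the `p`-adic integers `w x` and their residues
  let w : N → ℤ_[p] := fun x ↦ PadicInt.lift (hfcompat x) Polynomial.X
  have hw : ∀ x k, PadicInt.toZModPow k (w x) = r k x := by
    intro x k
    have h := PadicInt.lift_spec (hfcompat x) k
    have h' := DFunLike.congr_fun h Polynomial.X
    rw [RingHom.comp_apply] at h'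
    rw [show w x = PadicInt.lift (hfcompat x) Polynomial.X from rfl, h', hfX]
  -- additivity
  have hwadd : ∀ x y, w (x + y) = w x + w y := by
    intro x y
    refine PadicInt.ext_of_toZModPow.mp fun k ↦ ?_
    rw [map_add, hw, hw, hw, hradd]
  have hw0 : w 0 = 0 := by
    have h := hwadd 0 0
    rw [add_zero] at h
    have : w 0 + w 0 = w 0 + 0 := by rw [add_zero]; exact h.symm
    exact add_left_cancel this
  let wh : N →+ ℤ_[p] := { toFun := w, map_zero' := hw0, map_add' := hwadd }
  refine ⟨wh, fun d ↦ ?_⟩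
  obtain ⟨x, k, hd⟩ := (hD _).mp d.2
  have hd' : d = ⟨e x k, hmem x k⟩ := Subtype.ext hd
  obtain ⟨a, ha⟩ := ZMod.intCast_surjective (r k x)
  rw [hd', hrΦ k x a ha.symm]
  change _ = e x k wh
  rw [he x k wh a (by rw [show wh x = w x from rfl, hw, ha])]

end Literature.Algebra.Module

end
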